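import Mathlib
import Literature.GroupTheory.FiniteAbelian.AlternatingPairing
import Literature.GroupTheory.FiniteAbelian.CharacterModuleUnitAddCircle
import HarnessLib

/-!
# Seed crux `SignedMuSeedAtTwoPlus` (stmt-BirchSwinnertonDyer-21438), line `ct-involution-parity`:
# stub S1 `EvenSymplecticFreeParity` — the EVEN-SYMPLECTIC FREE-PARITY LAW (pure algebra), PROVED

Cell `bsd-wall`, width seat `bsd-wall-rtt-p4-w2` g9 on crux Kμ⁺ `SignedMuVanishingAtTwoPlus` (stmt-20689, line `birth`
v4.9: Kμ⁺ ⟺ item 21438 modulo Abbes–Ullmo).  The seed crux 21438 received the line `ct-involution-parity`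
(`Cruxes/SignedMuSeedAtTwoPlus/Lines/ct_involution_parity.lean`, crux-ideate k2 g11: Cassels–Tate evenness at the
involution ⇒ free `(ℤ/2^k)[C_{2^n}]`-summands of `Ш(W/ℚ_n)` come in pairs), whose first stub is the purely
algebraic law below; this file proves it, with `freeMult`, `gradeSub`, `normElt` unfolded VERBATIM, so that the
stub closes by `unfold EvenSymplecticFreeParity freeMult gradeSub normElt; exact evenSymplecticFreeParity`
(checked).  HONEST FRAMING: THEOREMS ONLY — no definition, no named fact, no instance, no `sorry`; no number
theory is imported; nothing about any curve is asserted; closes no item; BSD is NOT proved by any of this.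

## The law

Let `A` be a finite abelian group, `g ∈ End(A)` with `g^(2^n) = 1` (`n ≥ 1`), and `B : A × A → ℚ/ℤ` bi-additive,
left-nondegenerate, alternating (`B(x, x) = 0`), `g`-invariant (`B(gx, gy) = B(x, y)`) and EVEN AT THE INVOLUTION
`g₀ = g^(2^(n-1))` (`B(g₀ x, x) = 0`).  Put `N = ∑_{i<2^n} gⁱ`, `U_k = 2^(k-1) A ∩ A[2]`.  Then for every `k ≥ 1`
the grade-`k` free multiplicity `m_k = log₂ #(N(U_k) + U_{k+1}) − log₂ #U_{k+1}` (= the number of free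
`𝔽₂[C_{2^n}]`-summands of `U_k/U_{k+1}`, since `N = T^(2^n − 1)` in `𝔽₂[C_{2^n}] = 𝔽₂[T]/T^(2^n)`) is EVEN.
(Without evenness the law fails: `𝔽₂[C₂]` with the hyperbolic form is `g`-invariant alternating with `m_1 = 1`.)

## Proof (§4 `even_log_card_map_normSum_sup_sub_log_card`)

On `P = A[2^k]` consider `F(a, b) = B(a, 2^(k-1) N b) = B(2^(k-1) a, N b)`.
* §1 `F` is alternating: `∑_{i<2^n} B(2^(k-1) a, gⁱ a) = 0` — the terms `i` and `2^n − i` cancel by invariance and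
  antisymmetry, the fixed terms `i = 0` and `i = 2^(n-1)` vanish by alternation resp. evenness
  (`sum_apply_pow_self_eq_zero`, via `Finset.sum_involution`); and `N` is self-adjoint, `B(x, N y) = B(N x, y)`
  (`apply_normSum_eq`).
* §2 duality `A[q]^⊥ = qA` (`exists_nsmul_eq_of_forall_apply_eq_zero`): `a ↦ B(a, ·)` is a bijection
  `A → Hom(A, ℚ/ℤ)` (`#Hom(A, ℚ/ℤ) = #A`, `Literature…nonempty_characterModule_addEquiv`), and a character killing
  `A[q]` factors through `q·` because `ℚ/ℤ` is injective (`CharacterModule.dual_surjective_of_injective`).  Hence the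
  radical of `F` is `R = {a ∈ P : N(2^(k-1) a) ∈ 2^k A}`, and `2P ≤ R`.
* §3 (`exists_index_eq_pow_two_mul`) `F` descends to a nondegenerate alternating form on the elementary abelian
  `2`-group `P/R`, so `[P : R] = 2^(2m)` (`Literature…exists_natCard_torsionBy_eq_pow_two_mul_of_circle`).
* Counting: `a ↦ N(2^(k-1) a) mod U_{k+1}` maps `P` onto `(N(U_k) + U_{k+1})/U_{k+1}` (as `U_k = 2^(k-1)·A[2^k]`) with
  kernel `R`, so `#(N(U_k) + U_{k+1}) = 2^(2m) · #U_{k+1}`, and `#U_{k+1}` is a power of `2`.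

§5 `evenSymplecticFreeParity` restates §4 in the stub's binder shape (`k = j + 1`, `2 ^ (k + 1 - 1)`).

References: standard (Wall 1963 / Tignol–Amitsur 1986 for symplectic modules; Serre, *Cours d'arithmétique* VI §1
for characters of finite abelian groups); the law itself is the line card's S1 (`Lines/ct-involution-parity.md`,
`calc/claimS1.py`: 0/31 violations), here proved in general. [folklore]
-/

noncomputable section

set_option autoImplicit false
set_option linter.dupNamespace false

open scoped AddSubgroup
open Finset

namespace Summit.BirchSwinnertonDyer.BirchSwinnertonDyer.Theorems.SignedMuAtTwo.EvenSymplecticFreeParity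

variable {A : Type*} [AddCommGroup A]

/-! ### §1 The cyclic action: iterated invariance and the adjointness of the norm element -/

/-- Iterated invariance: `B (gⁱ x) (gⁱ y) = B x y`. [folklore] -/
theorem apply_pow_apply_pow {Q : Type*} [AddCommGroup Q] (B : A →+ A →+ Q) (g : AddMonoid.End A)
    (hinv : ∀ x y, B (g x) (g y) = B x y) (i : ℕ) (x y : A) :
    B ((g ^ i) x) ((g ^ i) y) = B x y := by
  induction i with
  | zero => simp [AddMonoid.End.coe_one]
  | succ i ih =>
    rw [pow_succ', AddMonoid.End.coe_mul, Function.comp_apply, Function.comp_apply, hinv, ih]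

/-- Moving a power of `g` across an invariant pairing when `g ^ m = 1`:
`B (gⁱ x) y = B x (g^(m-i) y)` for `i ≤ m`. [folklore] -/
theorem apply_pow_eq_apply_pow_sub {Q : Type*} [AddCommGroup Q] (B : A →+ A →+ Q)
    (g : AddMonoid.End A) (hinv : ∀ x y, B (g x) (g y) = B x y) {m : ℕ} (hgm : g ^ m = 1)
    {i : ℕ} (hi : i ≤ m) (x y : A) :
    B ((g ^ i) x) y = B x ((g ^ (m - i)) y) := by
  have h : (g ^ i) ((g ^ (m - i)) y) = y := by
    rw [← Function.comp_apply (f := ⇑(g ^ i)), ← AddMonoid.End.coe_mul, ← pow_add,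
      Nat.add_sub_cancel' hi, hgm, AddMonoid.End.coe_one, id]
  conv_lhs => rw [← h]
  rw [apply_pow_apply_pow B g hinv]

/-- Evaluation of the norm element `N = ∑_{i<m} gⁱ` (a sum in `AddMonoid.End A`). [folklore] -/
theorem normSum_apply (g : AddMonoid.End A) (m : ℕ) (y : A) :
    (∑ i ∈ range m, (g ^ i : AddMonoid.End A)) y = ∑ i ∈ range m, (g ^ i) y := by
  induction m with
  | zero => rw [sum_range_zero, sum_range_zero, AddMonoid.End.zero_apply]
  | succ m ih => rw [sum_range_succ, sum_range_succ, ← ih]; rfl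

/-- The norm element is self-adjoint for an invariant pairing: `B x (N y) = B (N x) y` for
`N = ∑_{i<m} gⁱ` (given through its values), `g ^ m = 1`. [folklore] -/
theorem apply_normSum_eq {Q : Type*} [AddCommGroup Q] (B : A →+ A →+ Q)
    (g : AddMonoid.End A) (hinv : ∀ x y, B (g x) (g y) = B x y) {m : ℕ} (hgm : g ^ m = 1)
    (N : A →+ A) (hN : ∀ y, N y = ∑ i ∈ range m, (g ^ i) y) (x y : A) :
    B x (N y) = B (N x) y := by
  rw [hN, hN, map_sum, map_sum, AddMonoidHom.finsetSum_apply]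
  -- `∑ B (gⁱ x) y = ∑ B x (g^(m-i) y)`; reflect and shift
  have h1 : ∀ i ∈ range m, B ((g ^ i) x) y = B x ((g ^ (m - 1 - i + 1)) y) := by
    intro i hi
    rw [mem_range] at hi
    rw [apply_pow_eq_apply_pow_sub B g hinv hgm hi.le, show m - 1 - i + 1 = m - i by omega]
  rw [sum_congr rfl h1, sum_range_reflect (fun i ↦ B x ((g ^ (i + 1)) y)) m]
  -- shift: `∑_{i<m} B x (g^(i+1) y) = ∑_{i<m} B x (gⁱ y)` as `g^m y = g^0 y`
  rcases Nat.eq_zero_or_pos m with rfl | hm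
  · simp
  · obtain ⟨m', rfl⟩ : ∃ m', m = m' + 1 := ⟨m - 1, by omega⟩
    rw [sum_range_succ (fun i ↦ B x ((g ^ (i + 1)) y)), sum_range_succ' (fun i ↦ B x ((g ^ i) y)),
      hgm, pow_zero]

/-- **Alternation of the norm form.** If `b` is alternating, `g`-invariant, `g ^ (2h) = 1` and
`b x (g^h x) = 0` for all `x` (evenness at the involution), then `∑_{i<2h} b x (gⁱ x) = 0`:
the terms `i` and `2h - i` cancel, and the two fixed terms `i = 0, h` vanish. [folklore] -/
theorem sum_apply_pow_self_eq_zero {Q : Type*} [AddCommGroup Q] (b : A →+ A →+ Q)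
    (g : AddMonoid.End A) (halt : ∀ x, b x x = 0) (hinv : ∀ x y, b (g x) (g y) = b x y)
    {h : ℕ} (hgm : g ^ (2 * h) = 1) (heven : ∀ x, b x ((g ^ h) x) = 0) (x : A) :
    ∑ i ∈ range (2 * h), b x ((g ^ i) x) = 0 := by
  refine sum_involution (fun i _ ↦ if i = 0 then 0 else 2 * h - i) ?_ ?_ ?_ ?_
  · intro i hi
    rw [mem_range] at hi
    split_ifs with h0
    · subst h0
      rw [pow_zero, AddMonoid.End.coe_one, id, halt, add_zero]
    · -- `b x (g^(2h-i) x) = b (gⁱ x) x = - b x (gⁱ x)`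
      rw [← apply_pow_eq_apply_pow_sub b g hinv hgm hi.le,
        Literature.GroupTheory.FiniteAbelian.eq_neg_of_alternating b halt ((g ^ i) x) x,
        add_neg_cancel]
  · intro i hi hne
    rw [mem_range] at hi
    split_ifs with h0
    · exact absurd (by subst h0; rw [pow_zero, AddMonoid.End.coe_one, id, halt]) hne
    · exact fun heq ↦ hne (by rw [show i = h by omega, heven])
  · intro i hi
    rw [mem_range] at hi ⊢
    split_ifs <;> omega
  · intro i hi
    rw [mem_range] at hi
    by_cases h0 : i = 0
    · simp [h0]
    · rw [if_neg h0, if_neg (by omega)]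
      omega


/-! ### §2 Duality: the orthogonal of the `q`-torsion is `qA` -/

open Literature.GroupTheory.FiniteAbelian in
/-- **`A[q]^⊥ = qA`.** For a finite abelian group with a left-nondegenerate `ℚ/ℤ`-valued pairing,
an element pairing trivially with the `q`-torsion is a `q`-th multiple:
`(∀ y, q • y = 0 → B x y = 0) → x ∈ qA`.  Proof: `a ↦ B a` is a bijection `A → Hom(A, ℚ/ℤ)`
(injective by nondegeneracy, `#Hom(A, ℚ/ℤ) = #A`); the character `B x` kills `A[q] = ker (q • ·)`,
so it factors as `ψ' ∘ (q • ·)` (characters extend along the injection `A/A[q] ↪ A` since `ℚ/ℤ` is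
injective, `CharacterModule.dual_surjective_of_injective`); `ψ' = B c`, whence `B x = B (q • c)`.
[folklore] -/
theorem exists_nsmul_eq_of_forall_apply_eq_zero [Finite A] (B : A →+ A →+ AddCircle (1 : ℚ))
    (hnd : ∀ x, (∀ y, B x y = 0) → x = 0) (q : ℕ) {x : A}
    (h : ∀ y, q • y = 0 → B x y = 0) : ∃ c : A, q • c = x := by
  -- `a ↦ B a` is a bijection onto the character module
  have hinj : Function.Injective (fun a ↦ (B a : CharacterModule A)) := by
    intro a b hab
    rw [← sub_eq_zero]
    refine hnd _ fun y ↦ ?_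
    rw [map_sub, AddMonoidHom.sub_apply, sub_eq_zero]
    exact DFunLike.congr_fun hab y
  obtain ⟨e⟩ := nonempty_characterModule_addEquiv A
  haveI : Finite (A →+ AddCircle (1 : ℚ)) := Finite.of_equiv A e.toEquiv.symm
  have hbij : Function.Bijective (fun a ↦ (B a : CharacterModule A)) :=
    hinj.bijective_of_nat_card_le (Nat.card_congr e.toEquiv).le
  -- factor the character `B x` through multiplication by `q`
  set mq : A →+ A := nsmulAddMonoidHom (α := A) q with hmq
  have hmq_apply : ∀ a, mq a = q • a := fun a ↦ rfl
  set ι : A ⧸ mq.ker →+ A := QuotientAddGroup.kerLift mq with hι_def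
  have hι : Function.Injective ι := QuotientAddGroup.kerLift_injective mq
  have hker : mq.ker ≤ (B x).ker := fun y hy ↦ by
    rw [AddMonoidHom.mem_ker] at hy ⊢; exact h y hy
  set ψbar : A ⧸ mq.ker →+ AddCircle (1 : ℚ) := QuotientAddGroup.lift mq.ker (B x) hker with hψbar
  obtain ⟨ψ', hψ'⟩ :=
    CharacterModule.dual_surjective_of_injective ι.toIntLinearMap hι (ψbar : CharacterModule _)
  have hψ'q : ∀ a : A, ψ' (q • a) = B x a := by
    intro a
    have h1 := DFunLike.congr_fun hψ' (QuotientAddGroup.mk a)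
    rw [CharacterModule.dual_apply] at h1
    change ψ' (ι (QuotientAddGroup.mk a)) = ψbar (QuotientAddGroup.mk a) at h1
    rwa [hι_def, QuotientAddGroup.kerLift_mk, hmq_apply, hψbar, QuotientAddGroup.lift_mk] at h1
  -- `ψ' = B c`, and `B (q • c) = B x`
  obtain ⟨c, hc⟩ := hbij.2 ψ'
  refine ⟨c, hinj ?_⟩
  change B (q • c) = B x
  ext y
  rw [map_nsmul, AddMonoidHom.nsmul_apply, ← map_nsmul, ← hψ'q y]
  exact DFunLike.congr_fun hc (q • y)

/-! ### §3 An alternating form with radical `R ⊇ 2P` has index `[P : R] = 2^(2m)` -/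

open Literature.GroupTheory.FiniteAbelian in
/-- **Square index of the radical.** If a finite abelian group `P` carries a bi-additive alternating
`ℚ/ℤ`-valued form `F` whose (left) radical is the subgroup `R`, and `2P ≤ R`, then `[P : R] = 2^(2m)`:
`F` descends to a nondegenerate alternating form on the elementary abelian `2`-group `P/R`, whose
order is therefore an even power of `2` (`exists_natCard_torsionBy_eq_pow_two_mul_of_circle`). [folklore] -/
theorem exists_index_eq_pow_two_mul {P : Type*} [AddCommGroup P] [Finite P]
    (F : P →+ P →+ AddCircle (1 : ℚ)) (halt : ∀ a, F a a = 0) (R : AddSubgroup P)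
    (hrad : ∀ a, a ∈ R ↔ ∀ b, F a b = 0) (h2 : ∀ a : P, (2 : ℕ) • a ∈ R) :
    ∃ m : ℕ, R.index = 2 ^ (2 * m) := by
  -- the radical is two-sided
  have hR : ∀ a : P, R ≤ (F a).ker := by
    intro a r hr
    rw [AddMonoidHom.mem_ker, eq_neg_of_alternating F halt a r, (hrad r).mp hr a, neg_zero]
  -- descend `F` to `P ⧸ R` in the second variable …
  let Φ₁ : P →+ (P ⧸ R →+ AddCircle (1 : ℚ)) :=
    { toFun := fun a ↦ QuotientAddGroup.lift R (F a) (hR a)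
      map_zero' := QuotientAddGroup.addMonoidHom_ext R (by
        ext b
        change F 0 b = 0
        rw [map_zero, AddMonoidHom.zero_apply])
      map_add' := fun a a' ↦ QuotientAddGroup.addMonoidHom_ext R (by
        ext b
        change F (a + a') b = F a b + F a' b
        rw [map_add, AddMonoidHom.add_apply]) }
  have hΦ₁ : ∀ a b : P, Φ₁ a (QuotientAddGroup.mk b) = F a b := fun _ _ ↦ rfl
  -- … and in the first variable
  have hRΦ : R ≤ Φ₁.ker := by
    intro r hr
    rw [AddMonoidHom.mem_ker]
    refine QuotientAddGroup.addMonoidHom_ext R ?_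
    ext b
    rw [AddMonoidHom.comp_apply, QuotientAddGroup.coe_mk', hΦ₁, (hrad r).mp hr b,
      AddMonoidHom.zero_comp, AddMonoidHom.zero_apply]
  let Fbar : P ⧸ R →+ P ⧸ R →+ AddCircle (1 : ℚ) := QuotientAddGroup.lift R Φ₁ hRΦ
  have hFbar : ∀ a b : P, Fbar (QuotientAddGroup.mk a) (QuotientAddGroup.mk b) = F a b := fun a b ↦ by
    change (QuotientAddGroup.lift R Φ₁ hRΦ (QuotientAddGroup.mk a)) (QuotientAddGroup.mk b) = F a b
    rw [QuotientAddGroup.lift_mk, hΦ₁]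
  have haltbar : ∀ z, Fbar z z = 0 := fun z ↦ by
    induction z using QuotientAddGroup.induction_on with
    | H a => rw [hFbar, halt]
  have hndbar : ∀ z, (∀ w, Fbar z w = 0) → z = 0 := fun z hz ↦ by
    induction z using QuotientAddGroup.induction_on with
    | H a =>
      exact (QuotientAddGroup.eq_zero_iff a).mpr
        ((hrad a).mpr fun b ↦ (hFbar a b).symm.trans (hz (QuotientAddGroup.mk b)))
  -- `P ⧸ R` is killed by `2`
  have htop : (P ⧸ R)[((2 : ℕ) : ℤ)] = ⊤ := eq_top_iff.mpr fun z _ ↦ by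
    induction z using QuotientAddGroup.induction_on with
    | H a =>
      rw [AddSubgroup.torsionBy.nsmul_iff, ← QuotientAddGroup.mk_nsmul, QuotientAddGroup.eq_zero_iff]
      exact h2 a
  obtain ⟨m, hm⟩ := exists_natCard_torsionBy_eq_pow_two_mul_of_circle 2 (P ⧸ R) Fbar haltbar hndbar
  refine ⟨m, ?_⟩
  rw [AddSubgroup.index_eq_card, ← AddSubgroup.card_top (G := P ⧸ R), ← htop, hm]

/-! ### §4 The free-parity law in grade `j + 1` -/

open Literature.GroupTheory.FiniteAbelian in
/-- **Even-symplectic free-parity law, grade `j+1`.** For a finite abelian group `A`, `g ∈ End A` with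
`g^(2^n) = 1` (`n ≥ 1`) and a left-nondegenerate alternating `g`-invariant pairing `B : A × A → ℚ/ℤ` even at
the involution (`B (g^(2^(n-1)) x) x = 0`): with `N = ∑_{i<2^n} gⁱ`, `U = 2^j A ∩ A[2]`, `U' = 2^(j+1) A ∩ A[2]`,
`log₂ #(N(U) + U') - log₂ #U'` is even (proof in the module docstring). [folklore] -/
theorem even_log_card_map_normSum_sup_sub_log_card [Finite A] (g : AddMonoid.End A)
    (B : A →+ A →+ AddCircle (1 : ℚ)) {n : ℕ} (hn : 1 ≤ n) (hg : g ^ (2 ^ n) = 1)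
    (hnd : ∀ x, (∀ y, B x y = 0) → x = 0) (halt : ∀ x, B x x = 0)
    (hinv : ∀ x y, B (g x) (g y) = B x y) (heven : ∀ x, B ((g ^ (2 ^ (n - 1))) x) x = 0) (j : ℕ) :
    Even (Nat.log 2 (Nat.card ↥((((2 ^ j) • AddMonoidHom.id A).range ⊓ AddSubgroup.torsionBy A 2).map
        (∑ i ∈ Finset.range (2 ^ n), (g ^ i : AddMonoid.End A)) ⊔
        (((2 ^ (j + 1)) • AddMonoidHom.id A).range ⊓ AddSubgroup.torsionBy A 2))) -
      Nat.log 2 (Nat.card ↥(((2 ^ (j + 1)) • AddMonoidHom.id A).range ⊓ AddSubgroup.torsionBy A 2))) := by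
  -- notation
  set N : A →+ A := ∑ i ∈ Finset.range (2 ^ n), (g ^ i : AddMonoid.End A) with hN
  set T₂ : AddSubgroup A := AddSubgroup.torsionBy A 2 with hT₂
  set U : AddSubgroup A := ((2 ^ j) • AddMonoidHom.id A).range ⊓ T₂ with hU
  set U' : AddSubgroup A := ((2 ^ (j + 1)) • AddMonoidHom.id A).range ⊓ T₂ with hU'
  set V : AddSubgroup A := U.map N ⊔ U' with hV
  set P : AddSubgroup A := AddSubgroup.torsionBy A ((2 ^ (j + 1) : ℕ) : ℤ) with hP
  -- elementary membership facts
  have hNapply : ∀ y, N y = ∑ i ∈ Finset.range (2 ^ n), (g ^ i) y := fun y ↦ normSum_apply g _ y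
  have memT₂ : ∀ x, x ∈ T₂ ↔ (2 : ℕ) • x = 0 := fun x ↦ by
    rw [hT₂, show (2 : ℤ) = ((2 : ℕ) : ℤ) from rfl]
    exact AddSubgroup.torsionBy.nsmul_iff
  have memP : ∀ x, x ∈ P ↔ 2 ^ (j + 1) • x = 0 := fun x ↦ AddSubgroup.torsionBy.nsmul_iff
  have memRange : ∀ (c : ℕ) (x : A), x ∈ (c • AddMonoidHom.id A).range ↔ ∃ a, c • a = x :=
    fun c x ↦ by simp only [AddMonoidHom.mem_range, AddMonoidHom.nsmul_apply, AddMonoidHom.id_apply]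
  have hU_eq : U = P.map ((2 ^ j) • AddMonoidHom.id A) := by
    ext x
    rw [hU, AddSubgroup.mem_inf, memRange, memT₂, AddSubgroup.mem_map]
    constructor
    · rintro ⟨⟨a, rfl⟩, h2⟩
      exact ⟨a, (memP a).mpr (by rwa [pow_succ, mul_nsmul]), rfl⟩
    · rintro ⟨a, ha, rfl⟩
      refine ⟨⟨a, rfl⟩, ?_⟩
      rwa [AddMonoidHom.nsmul_apply, AddMonoidHom.id_apply, ← mul_nsmul, ← pow_succ, ← memP]
  -- the comparison map `θ : P → A/U'`, `a ↦ N(2^j a)`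
  let θ : ↥P →+ A ⧸ U' :=
    (QuotientAddGroup.mk' U').comp ((N.comp ((2 ^ j) • AddMonoidHom.id A)).comp P.subtype)
  have hθ : ∀ a : ↥P, θ a = QuotientAddGroup.mk (N ((2 ^ j) • (a : A))) := fun _ ↦ rfl
  have hθrange : θ.range = (U.map N).map (QuotientAddGroup.mk' U') := by
    change ((QuotientAddGroup.mk' U').comp ((N.comp ((2 ^ j) • AddMonoidHom.id A)).comp
      P.subtype)).range = _
    rw [← AddMonoidHom.map_range, ← AddMonoidHom.map_range, AddSubgroup.range_subtype,
      ← AddSubgroup.map_map, ← hU_eq]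
  have hVcomap : (θ.range).comap (QuotientAddGroup.mk' U') = V := by
    rw [hθrange, AddSubgroup.comap_map_eq, QuotientAddGroup.ker_mk']
  have hVindex : V.index = θ.range.index :=
    hVcomap ▸ θ.range.index_comap_of_surjective (QuotientAddGroup.mk'_surjective U')
  have hcardV : Nat.card V = Nat.card θ.range * Nat.card U' := by
    have h1 := AddSubgroup.card_mul_index V
    have h2 := AddSubgroup.card_mul_index θ.range
    have h3 := AddSubgroup.card_eq_card_quotient_mul_card_addSubgroup U'
    have hne : V.index ≠ 0 := AddSubgroup.index_ne_zero_of_finite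
    rw [hVindex] at h1 hne
    have : Nat.card V * θ.range.index = Nat.card θ.range * Nat.card U' * θ.range.index := by
      rw [h1, h3, ← h2]; ring
    exact Nat.eq_of_mul_eq_mul_right (Nat.pos_of_ne_zero hne) this
  -- the alternating form `F(a, b) = B(a, 2^j N b)` on `P`, and its radical `θ.ker`
  let F : ↥P →+ ↥P →+ AddCircle (1 : ℚ) :=
    (B.comp P.subtype).compl₂ ((((2 ^ j) • AddMonoidHom.id A).comp N).comp P.subtype)
  have hF : ∀ a b : ↥P, F a b = B (a : A) ((2 ^ j) • N (b : A)) := fun _ _ ↦ rfl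
  have hF' : ∀ a b : ↥P, F a b = B (N ((2 ^ j) • (a : A))) (b : A) := by
    intro a b
    rw [hF, map_nsmul, ← AddMonoidHom.nsmul_apply, ← map_nsmul, apply_normSum_eq B g hinv hg N hNapply]
  have hm : 2 ^ n = 2 * 2 ^ (n - 1) := by rw [← pow_succ', Nat.sub_add_cancel hn]
  have haltF : ∀ a : ↥P, F a a = 0 := by
    intro a
    rw [hF, map_nsmul, ← AddMonoidHom.nsmul_apply, ← map_nsmul, hNapply, map_sum]
    -- the form `b(x, y) = B(2^j x, y)`
    have key := sum_apply_pow_self_eq_zero (B.comp ((2 ^ j) • AddMonoidHom.id A)) g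
      (fun x ↦ by
        rw [AddMonoidHom.comp_apply, AddMonoidHom.nsmul_apply, AddMonoidHom.id_apply, map_nsmul,
          AddMonoidHom.nsmul_apply, halt, smul_zero])
      (fun x y ↦ by
        rw [AddMonoidHom.comp_apply, AddMonoidHom.comp_apply, AddMonoidHom.nsmul_apply,
          AddMonoidHom.nsmul_apply, AddMonoidHom.id_apply, AddMonoidHom.id_apply, ← map_nsmul, hinv])
      (h := 2 ^ (n - 1)) (by rw [← hm]; exact hg)
      (fun x ↦ by
        rw [AddMonoidHom.comp_apply, AddMonoidHom.nsmul_apply, AddMonoidHom.id_apply, map_nsmul,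
          AddMonoidHom.nsmul_apply, eq_neg_of_alternating B halt x, heven, neg_zero, smul_zero])
      (a : A)
    rw [← hm] at key
    simpa only [AddMonoidHom.comp_apply, AddMonoidHom.nsmul_apply, AddMonoidHom.id_apply] using key
  have hker : ∀ a : ↥P, a ∈ θ.ker ↔ ∃ c : A, 2 ^ (j + 1) • c = N ((2 ^ j) • (a : A)) := by
    intro a
    rw [AddMonoidHom.mem_ker, hθ, QuotientAddGroup.eq_zero_iff, hU', AddSubgroup.mem_inf, memRange,
      memT₂]
    refine ⟨fun h ↦ h.1, fun h ↦ ⟨h, ?_⟩⟩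
    rw [← map_nsmul, ← mul_nsmul, ← pow_succ, (memP _).mp a.2, map_zero]
  have hradF : ∀ a : ↥P, a ∈ θ.ker ↔ ∀ b : ↥P, F a b = 0 := by
    intro a
    rw [hker]
    constructor
    · rintro ⟨c, hc⟩ b
      rw [hF', ← hc, map_nsmul, AddMonoidHom.nsmul_apply, ← map_nsmul, (memP _).mp b.2, map_zero]
    · intro h
      refine exists_nsmul_eq_of_forall_apply_eq_zero B hnd (2 ^ (j + 1)) fun y hy ↦ ?_
      have := h ⟨y, (memP y).mpr hy⟩
      rwa [hF'] at this
  have h2F : ∀ a : ↥P, (2 : ℕ) • a ∈ θ.ker := fun a ↦ (hker _).mpr ⟨0, by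
    rw [AddSubgroup.coe_nsmul, ← mul_nsmul, ← pow_succ', (memP _).mp a.2, map_zero, smul_zero]⟩
  obtain ⟨m, hm2⟩ := exists_index_eq_pow_two_mul F haltF θ.ker hradF h2F
  -- `#U'` is a power of `2`
  haveI : Fact (Nat.Prime 2) := ⟨Nat.prime_two⟩
  letI : Module (ZMod 2) ↥U' := AddCommGroup.zmodModule (fun x ↦ Subtype.ext (by
    rw [AddSubgroup.coe_nsmul, AddSubgroup.coe_zero]
    exact (memT₂ _).mp (AddSubgroup.mem_inf.mp x.2).2))
  have hcardU' : Nat.card ↥U' = 2 ^ Module.finrank (ZMod 2) ↥U' := (pow_finrank_eq_natCard 2 ↥U').symm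
  -- conclusion
  have hcardV' : Nat.card V = 2 ^ (2 * m + Module.finrank (ZMod 2) ↥U') := by
    rw [hcardV, ← AddSubgroup.index_ker, hm2, hcardU', ← pow_add]
  rw [hcardV', hcardU', Nat.log_pow Nat.one_lt_two, Nat.log_pow Nat.one_lt_two, Nat.add_sub_cancel]
  exact even_two_mul m

/-! ### §5 The law in the binder shape of stub S1 `EvenSymplecticFreeParity` (line `ct-involution-parity`) -/

/-- **The even-symplectic free-parity law (stub S1 `EvenSymplecticFreeParity` of line `ct-involution-parity`
of crux `SignedMuSeedAtTwoPlus`, stmt-BirchSwinnertonDyer-21438, VERBATIM with `freeMult`, `gradeSub`, `normElt`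
unfolded).** A finite abelian group `A` with an endomorphism `g`, `g^(2^n) = 1` (`n ≥ 1`), carrying a
nondegenerate alternating `g`-invariant `ℚ/ℤ`-valued pairing that is even for the involution `g^(2^(n-1))`
has even free multiplicity `m_k(A) = log₂ #(N(U_k) + U_{k+1}) - log₂ #U_{k+1}` in every grade `k ≥ 1`
(`U_k = 2^(k-1) A ∩ A[2]`, `N = ∑_{i<2^n} gⁱ`).  The registered stub closes by
`unfold EvenSymplecticFreeParity freeMult gradeSub normElt; exact evenSymplecticFreeParity`. [folklore] -/
theorem evenSymplecticFreeParity :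
    ∀ (n : ℕ), 1 ≤ n → ∀ (A : Type) [AddCommGroup A] [Finite A] (g : AddMonoid.End A)
      (B : A →+ A →+ AddCircle (1 : ℚ)),
      g ^ (2 ^ n) = 1 →
      (∀ x, (∀ y, B x y = 0) → x = 0) →
      (∀ x, B x x = 0) →
      (∀ x y, B (g x) (g y) = B x y) →
      (∀ x, B ((g ^ (2 ^ (n - 1))) x) x = 0) →
      ∀ k, 1 ≤ k →
        Even (Nat.log 2 (Nat.card ↥((((2 ^ (k - 1)) • AddMonoidHom.id A).range ⊓
              AddSubgroup.torsionBy A 2).map (∑ i ∈ Finset.range (2 ^ n), (g ^ i : AddMonoid.End A)) ⊔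
            (((2 ^ (k + 1 - 1)) • AddMonoidHom.id A).range ⊓ AddSubgroup.torsionBy A 2))) -
          Nat.log 2 (Nat.card ↥(((2 ^ (k + 1 - 1)) • AddMonoidHom.id A).range ⊓
            AddSubgroup.torsionBy A 2))) := by
  intro n hn A _ _ g B hg hnd halt hinv heven k hk
  obtain ⟨j, rfl⟩ : ∃ j, k = j + 1 := ⟨k - 1, (Nat.sub_add_cancel hk).symm⟩
  simp only [Nat.add_sub_cancel]
  exact even_log_card_map_normSum_sup_sub_log_card g B hn hg hnd halt hinv heven j

end Summit.BirchSwinnertonDyer.BirchSwinnertonDyer.Theorems.SignedMuAtTwo.EvenSymplecticFreeParity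

end
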